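import Summits.Langlands.Langlands.Theorems.IrreducibilityBySelfDualityPairLBoundaryJSGapLocalSingleDatumOfProductForm
import Summits.Langlands.Langlands.Theorems.IrreducibilityBySelfDualityPairLBoundaryJSGapUnitBoxProductForm

/-!
# Crux `PairLBoundaryJS` (stmt-Langlands-13622), line `Sketch` — stub `stub_gap_local_single_datum` (G-LSD):
# ONE archimedean `GL_n × GL_m` datum realised inside the translated gap box integral

Summit `Langlands`, sub-problem `Langlands`, helper file under `Theorems/` supporting the crux
`PairLBoundaryJS` (Arthur–Clozel (1989), Ch. 3, (2.2)), line `Sketch`, registered stub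
`stub_gap_local_single_datum` (part 2 of 2).

The per-datum core of the local Rankin–Selberg theory of a cuspidal pair `(P, Q)`, `P` cuspidal on
`GL_n(𝔸_K)`, `Q` cuspidal on `GL_m(𝔸_K)`, `0 < m < n`, in translate form (Jacquet–Piatetski-Shapiro–Shalika
(1983), (2.7) at the finite places of `S₀`, by spread data; Cogdell (2004), §4.1, `Ψ = ∏_v Ψ_v` for
factorizable data). Given torus shifts `τ ∈ (𝔸_Kˣ)ᵐ`, `T ∈ (𝔸_Kˣ)ⁿ` trivial at `S₀ ∪ ∞`, pure tensors
`S₁ ∈ π_f`, `S₁' ∈ σ_f` of levels `K_f(𝔫P)`, `K_f(𝔫Q)` with `𝔫P 𝔫Q` supported on `S₀`, and `K_∞`-finite Gårding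
vectors `e`, `e'` of the archimedean components `τP`, `τQ`, there are a level `𝔫` supported on `S₀`, HONEST
continuous cusp forms `Φ`, `Φ'` (right `K(𝔫)`-invariant, representing vectors of `π`, `σ`) and `κ > 0` with
`∫_{B({v ∉ S₀}) × K} W_Φ(diag(T) ι ·) W̄_{Φ'}(diag τ ·) |det|^s δ⁻¹ = κ · Ψ^{(n,m)}_∞(s; Φ_λ(diag(T)_f S₁), Φ_λ'(diag(τ)_f S₁'), e, e')`
for every `s` (`ι = glCorner (m ≤ n)`, `archGapPairIntegralCplx` against the image Haar measures).

This file is the one-line specialisation of the conditional theorem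
`GapLocalSingleDatum.gap_local_single_datum_of_productForm` (part 1, `…GapLocalSingleDatumOfProductForm`: the whole
assembly — spread datum, level-weight fixing, honesty, archimedean values, coset averaging — GRANTED the gap
product form) to the landed support collapse and product form of the translated gap pair integrand on the unit
box, `GapUnitBoxProductForm.stub_gap_unitBox_productForm` (`…GapUnitBoxProductForm`).

All proofs complete; tree theorems only.

## References

* H. Jacquet, I. I. Piatetski-Shapiro, J. A. Shalika, *Rankin–Selberg convolutions*, Amer. J. Math.
  105 (1983), §2, (2.7) [JacquetPiatetskiShapiroShalika1983].
* J. W. Cogdell, *Analytic theory of L-functions for GL_n*, in *An Introduction to the Langlands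
  Program* (2004), §1.2, §2.3, §4.1 [CogdellAnalyticTheory2004].
-/

noncomputable section

-- `Summit.Langlands.Langlands.…` (summit = sub-problem name, D-0017 layout) trips `dupNamespace`
set_option linter.dupNamespace false

open scoped MatrixGroups Topology Pointwise ENNReal NNReal ComplexConjugate InnerProductSpace ContDiff
-- the place subtypes indexing `mixedSpace K` are `Fintype` classically (`NormedCommRing (mixedSpace K)`)
open scoped Classical Matrix.Norms.Operator
open NumberField IsDedekindDomain MeasureTheory Measure Matrix Set Filter WithZero
open NumberField.mixedEmbedding
open Literature.NumberTheory.Automorphic AdelicGroupData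
open Literature.NumberTheory.GaloisRepresentations (ideleGroup HeckeCharacter)
open Literature.MeasureTheory.Group
open Literature.RingTheory.SymmetricFunctions.SymmPoly
open ValuativeRel

-- the automorphic quotient carries the tree's Borel σ-algebra, not Mathlib's quotient σ-algebra
attribute [-instance] Quotient.instMeasurableSpace QuotientGroup.measurableSpace

-- the house local instances, exactly as in `RankinSelbergUnfoldingIdentity`
attribute [local instance] adelicBorel borelSpace_adelic locallyCompactSpace_adelic secondCountableTopology_gl_adelic
  glAdeleBorel borelSpace_glAdele borelSpace_ideleGroup secondCountableTopology_ideleGroup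

-- Mathlib idiom: the commutator Lie ring on matrices, to mention `(archGroupGL n K).lie`
attribute [local instance 100] LieRing.ofAssociativeRing

namespace Summit.Langlands.Langlands.Theorems.GapLocalSingleDatum

/-- **STUB (G-LSD) — ONE archimedean `GL_n × GL_m` datum realised inside the translated gap box integral**
(the `GL_n × GL_m` version of `CornerLocalSingleDatum.stub_corner_local_single_datum`; Jacquet–Piatetski-Shapiro–Shalika
(1983), (2.7) at the finite places of `S₀` by spread data; Cogdell (2004), §4.1, `Ψ = ∏_v Ψ_v`). Given torus shifts
`τ ∈ (𝔸_Kˣ)ᵐ`, `T ∈ (𝔸_Kˣ)ⁿ` trivial at `S₀ ∪ ∞`, pure tensors `S₁ ∈ π_f` (`π` cuspidal on `GL_n`), `S₁' ∈ σ_f`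
(`σ` cuspidal on `GL_m`) of levels `K_f(𝔫P)`, `K_f(𝔫Q)` with `𝔫P 𝔫Q` supported on `S₀`, and `K_∞`-finite Gårding
vectors `e`, `e'` of the archimedean components `τP`, `τQ`, there are a level `𝔫` supported on `S₀`, HONEST
continuous representatives `Φ`, `Φ'` of vectors `sv ∈ π`, `sv' ∈ σ`, right `K(𝔫)`-invariant, and `κ > 0` with, for
every `s`, `∫_{B({v ∉ S₀}) × K} W_Φ(diag(T) ι ·) W̄_{Φ'}(diag τ ·) |det|^s δ⁻¹ = κ · Ψ^{(n,m)}_∞(s; Φ_λ(diag(T)_f S₁),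
Φ_λ'(diag(τ)_f S₁'), e, e')` (`archGapPairIntegralCplx` against the image Haar measures):
`gap_local_single_datum_of_productForm` applied to the gap product form `GapUnitBoxProductForm.stub_gap_unitBox_productForm`.
[cite: CogdellAnalyticTheory2004, §4.1] [cite: JacquetPiatetskiShapiroShalika1983, §2 (2.7)] -/
theorem stub_gap_local_single_datum :
    ∀ {n m : ℕ} {K : Type} [Field K] [NumberField K]
      {μ : Measure (gl n K).automorphicQuotient} [(gl n K).IsAutomorphicMeasure μ]
      {μ' : Measure (gl m K).automorphicQuotient} [(gl m K).IsAutomorphicMeasure μ']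
      [MeasurableSpace (AdeleRing (𝓞 K) K)] [BorelSpace (AdeleRing (𝓞 K) K)] (_hm : 0 < m) (hmn : m < n)
      (hcpt : isCompact_glFiniteIntegralLevel n K) (hcpt' : isCompact_glFiniteIntegralLevel m K)
      (P : CuspidalAutomorphicRepGL n K μ) (Q : CuspidalAutomorphicRepGL m K μ')
      (νA : Measure (Fin m → ideleGroup K)) [IsHaarMeasure νA]
      (νK : Measure ↥(maximalCompactAdelic m K)) [IsHaarMeasure νK]
      (ν₀ : Measure ↥(adelicUnipotent n K)) [IsHaarMeasure ν₀]
      (ν₀' : Measure ↥(adelicUnipotent m K)) [IsHaarMeasure ν₀']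
      {E : Type} [NormedAddCommGroup E] [InnerProductSpace ℂ E] [CompleteSpace E]
      {τP : ContRepresentation ℂ (archGroupGL n K).carrier E} (hτPc : τP.IsStronglyContinuous)
      {E' : Type} [NormedAddCommGroup E'] [InnerProductSpace ℂ E'] [CompleteSpace E']
      {τQ : ContRepresentation ℂ (archGroupGL m K).carrier E'} (hτQc : τQ.IsStronglyContinuous)
      (S₀ : Finset (HeightOneSpectrum (𝓞 K))) (τ : Fin m → ideleGroup K) (T : Fin n → ideleGroup K)
      (_ : GLn.toMixed m K (glDiagonal m (AdeleRing (𝓞 K) K) τ) = 1)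
      (_ : ∀ v ∈ S₀, localComponent v (glDiagonal m (AdeleRing (𝓞 K) K) τ) = 1)
      (_ : GLn.toMixed n K (glDiagonal n (AdeleRing (𝓞 K) K) T) = 1)
      (_ : ∀ v ∈ S₀, localComponent v (glDiagonal n (AdeleRing (𝓞 K) K) T) = 1)
      {𝔫P 𝔫Q : Ideal (𝓞 K)} (_ : 𝔫P ≠ 0) (_ : 𝔫Q ≠ 0)
      (_ : ∀ w ∉ S₀, ¬ w.asIdeal ∣ 𝔫P * 𝔫Q)
      (S₁ : multiplicityModule hcpt τP P.1)
      (_ : (S₁ : E →L[ℂ] (gl n K).L2 μ) ∈ archIntertwinersLevel hcpt τP P.1 (finitePrincipalCongruenceLevel n K 𝔫P))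
      (S₁' : multiplicityModule hcpt' τQ Q.1)
      (_ : (S₁' : E' →L[ℂ] (gl m K).L2 μ') ∈ archIntertwinersLevel hcpt' τQ Q.1 (finitePrincipalCongruenceLevel m K 𝔫Q))
      (e : archGardingSpace hcpt τP) (e' : archGardingSpace hcpt' τQ)
      (_ : FiniteDimensional ℂ (Submodule.span ℂ (Set.range
        fun κ : ↥(Kinf n K) => τP (toArch hcpt κ.1) e.1)))
      (_ : FiniteDimensional ℂ (Submodule.span ℂ (Set.range
        fun κ : ↥(Kinf m K) => τQ (toArch hcpt' κ.1) e'.1)))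
      [MeasurableSpace (GL (Fin m) (mixedSpace K))] [BorelSpace (GL (Fin m) (mixedSpace K))],
    ∃ (𝔫 : Ideal (𝓞 K)) (_ : 𝔫 ≠ 0) (_ : ∀ w ∉ S₀, ¬ w.asIdeal ∣ 𝔫)
      (Φ : (gl n K).automorphicQuotient → ℂ) (Φ' : (gl m K).automorphicQuotient → ℂ)
      (sv : P.1.toSubmodule) (sv' : Q.1.toSubmodule) (_ : Continuous Φ) (_ : Continuous Φ')
      (_ : ((sv : (gl n K).L2 μ) : _ → ℂ) =ᵐ[μ] Φ)
      (_ : ((sv' : (gl m K).L2 μ') : _ → ℂ) =ᵐ[μ'] Φ')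
      (_ : IsCuspFormGL n K hcpt (invQuot (gl n K) Φ))
      (_ : IsCuspFormGL m K hcpt' (invQuot (gl m K) Φ'))
      (_ : ∀ u ∈ principalCongruenceLevel n K 𝔫, ∀ y, invQuot (gl n K) Φ (y * u :) = invQuot (gl n K) Φ y)
      (_ : ∀ u ∈ principalCongruenceLevel m K 𝔫, ∀ y, invQuot (gl m K) Φ' (y * u :) = invQuot (gl m K) Φ' y)
      (κ : ℝ), 0 < κ ∧
      ∀ s,
        ∫ p in unitBox {v | v ∉ (↑S₀ : Set _)} ×ˢ univ,
          torusPairIntegrandC m K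
            (fun g => whittakerCoeff ν₀ (unipotentTateDomain n K) (adeleAddChar K) (invQuot (gl n K) Φ)
              (glDiagonal n (AdeleRing (𝓞 K) K) T * glCorner (AdeleRing (𝓞 K) K) hmn.le g))
            (fun g => star (whittakerCoeff ν₀' (unipotentTateDomain m K) (adeleAddChar K) (invQuot (gl m K) Φ')
              (glDiagonal m (AdeleRing (𝓞 K) K) τ * g)))
            (fun _ => 1) s p ∂(νA.prod νK) =
        (κ : ℂ) * archGapPairIntegralCplx hmn.le hcpt hcpt' τP hτPc τQ hτQc
          (transferMap (whittakerFunctional ν₀ (continuous_adeleAddChar K) (ContRepresentation.Equiv.refl P.1.toContRep)) hτPc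
            (finComponentRep hcpt τP P.1 (GLn.sndHom n K (glDiagonal n (AdeleRing (𝓞 K) K) T)) S₁))
          (transferMap (whittakerFunctional ν₀' (continuous_adeleAddChar K) (ContRepresentation.Equiv.refl Q.1.toContRep)) hτQc
            (finComponentRep hcpt' τQ Q.1 (GLn.sndHom m K (glDiagonal m (AdeleRing (𝓞 K) K) τ)) S₁')) e e'
          ((νA.restrict (unitBox univ)).map (archTorusOfIdele m K)) (νK.map (kinfOfMaximalCompact m K)) s :=
  gap_local_single_datum_of_productForm GapUnitBoxProductForm.stub_gap_unitBox_productForm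

end Summit.Langlands.Langlands.Theorems.GapLocalSingleDatum

end
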